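import Literature.Geometry.DiscreteGeometry.LayerStackings
import Literature.Barriers.AtomisticToContinuum.KissingTwelveDegeneracy
import Literature.MathematicalPhysics.StatisticalMechanics.BarlowStacking
import Literature.MathematicalPhysics.StatisticalMechanics.BarlowCoordination
import Mathlib.Analysis.Normed.Affine.MazurUlam

/-!
# drefute evidence for line `c-layer-witness-strictness` (crux `SlackRigidity`, stmt-AtomisticToContinuum-11960):
a sorry-free proof of `stub_layeringIdeal` (layering AT the ideal ratio) from the PROVED tree theorem
`HalesDSP_layerPackings_holds` (Hales, *Dense Sphere Packings* §1.3)

POSITIVE evidence (refuter seat `refuter-drefute-stmt-AtomisticToContinuum-11960-0`): the stub as registered is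
TRUE; `stub_layeringIdeal_proof` proves its statement verbatim.  Reduction: scale `Y` by `c = 2/a`
(`barlowPos (c a) (c h) = c • barlowPos a h`, `c h = 2√(2/3)` from `h² = 2a²/3`); the scaled set is a unit-ball
packing (a `6a/5`-star has only the distances `0, a`: `le_dist_of_mem_barlowStacking_ideal`) whose kissing shells
are linear-isometric images of the shell of `0` in a model stacking, hence FCC/HCP patterns
(`HalesDSP_stackingShells_holds`); Hales' theorem gives `V = g '' barlowStacking 2 (2√(2/3)) s₁` with `g` an
isometry; re-rooting at `x₀ = g⁻¹ 0` (`barlowStacking − barlowPos s k₀ i₀ j₀ = barlowStacking (s ∘ (· + k₀))`) and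
Mazur–Ulam (`IsometryEquiv.toRealLinearIsometryEquivOfMapZero`) make the isometry LINEAR; unscale.
-/

noncomputable section

namespace Summit.AtomisticToContinuum.Crystallization.Cruxes.SlackRigidity.DrefuteEvidence

open Literature.MathematicalPhysics.StatisticalMechanics
open Literature.Geometry.DiscreteGeometry (IsUnitBallPacking kissingShell HasFccOrHcpShells IsArrangedIn
  HalesDSP_layerPackings_holds mem_kissingShell_iff)

/-- Ambient space `ℝ³`. -/
local notation "E3" => EuclideanSpace ℝ (Fin 3)

/-! ## Scaling -/

/-- `barlowPos` is jointly linear in the two spacings. [folklore] -/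
theorem barlowPos_scale (c a h : ℝ) (s : ℤ → ℤ) (k i j : ℤ) :
    barlowPos (c * a) (c * h) s k i j = c • barlowPos a h s k i j := by
  ext l
  fin_cases l
  · simp [-mul_eq_mul_left_iff]; ring
  · simp [-mul_eq_mul_left_iff]; ring
  · simp [-mul_eq_mul_left_iff]; ring

/-- Scaling a Barlow stacking scales both spacings. [folklore] -/
theorem barlowStacking_scale (c a h : ℝ) (s : ℤ → ℤ) :
    barlowStacking (c * a) (c * h) s = (fun x : E3 => c • x) '' barlowStacking a h s := by
  ext x
  constructor
  · rintro ⟨k, i, j, rfl⟩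
    exact ⟨barlowPos a h s k i j, barlowPos_mem k i j, (barlowPos_scale c a h s k i j).symm⟩
  · rintro ⟨y, ⟨k, i, j, rfl⟩, rfl⟩
    exact ⟨k, i, j, (barlowPos_scale c a h s k i j).symm⟩

/-- The ideal ratio: `h² = 2a²/3`, `a, h > 0` give `h = a √(2/3)`. [folklore] -/
theorem h_eq_of_ideal {a h : ℝ} (ha : 0 < a) (hh : 0 < h) (hid : h ^ 2 = 2 * a ^ 2 / 3) :
    h = a * Real.sqrt (2 / 3) := by
  have e : h = Real.sqrt (h ^ 2) := (Real.sqrt_sq hh.le).symm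
  rw [e, hid, show 2 * a ^ 2 / 3 = a ^ 2 * (2 / 3) by ring, Real.sqrt_mul (sq_nonneg a),
    Real.sqrt_sq ha.le]

/-- The root `barlowPos s 0 0 0` is the origin. [folklore] -/
theorem barlowPos_zero (a h : ℝ) (s : ℤ → ℤ) : barlowPos a h s 0 0 0 = 0 := by
  simp [barlowPos]

/-! ## Re-rooting a stacking at one of its points -/

/-- Labels of the shifted sequence. [folklore] -/
theorem haggLabel_shift (s : ℤ → ℤ) (k₀ n : ℤ) :
    haggLabel (fun m => s (m + k₀)) n = haggLabel s (n + k₀) - haggLabel s k₀ := by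
  induction n using Int.induction_on with
  | zero => simp
  | succ n ih =>
    rw [haggLabel_succ, ih, show (n : ℤ) + 1 + k₀ = (n + k₀) + 1 by ring, haggLabel_succ]
    ring
  | pred n ih =>
    have e1 := haggLabel_succ (fun m => s (m + k₀)) (-(n : ℤ) - 1)
    rw [show -(n : ℤ) - 1 + 1 = -n by ring] at e1
    have e2 := haggLabel_succ s (-(n : ℤ) - 1 + k₀)
    rw [show -(n : ℤ) - 1 + k₀ + 1 = -n + k₀ by ring] at e2
    linarith

/-- Differences of stacking points are points of the re-rooted (shifted) stacking. [folklore] -/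
theorem barlowPos_sub_barlowPos_shift (a h : ℝ) (s : ℤ → ℤ) (k₀ i₀ j₀ k i j : ℤ) :
    barlowPos a h s k i j - barlowPos a h s k₀ i₀ j₀ =
      barlowPos a h (fun m => s (m + k₀)) (k - k₀) (i - i₀) (j - j₀) := by
  have hL : haggLabel (fun m => s (m + k₀)) (k - k₀) = haggLabel s k - haggLabel s k₀ := by
    rw [haggLabel_shift, sub_add_cancel]
  ext l
  fin_cases l
  · simp [hL, -mul_eq_mul_left_iff]; ring
  · simp [hL, -mul_eq_mul_left_iff]; ring
  · simp [-mul_eq_mul_left_iff]; ring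

/-- **Re-rooting**: `barlowStacking a h s − barlowPos s k₀ i₀ j₀ = barlowStacking a h (s ∘ (· + k₀))`. [folklore] -/
theorem barlowStacking_shift (a h : ℝ) (s : ℤ → ℤ) (k₀ i₀ j₀ : ℤ) :
    (fun x => x - barlowPos a h s k₀ i₀ j₀) '' barlowStacking a h s =
      barlowStacking a h (fun m => s (m + k₀)) := by
  ext x
  constructor
  · rintro ⟨_, ⟨k, i, j, rfl⟩, rfl⟩
    exact ⟨k - k₀, i - i₀, j - j₀, barlowPos_sub_barlowPos_shift a h s k₀ i₀ j₀ k i j⟩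
  · rintro ⟨k, i, j, rfl⟩
    refine ⟨barlowPos a h s (k + k₀) (i + i₀) (j + j₀), barlowPos_mem _ _ _, ?_⟩
    show barlowPos a h s (k + k₀) (i + i₀) (j + j₀) - barlowPos a h s k₀ i₀ j₀ = _
    rw [barlowPos_sub_barlowPos_shift]
    simp

/-! ## Patterns are transported by linear isometries -/

/-- A linear-isometric image of a set arranged in a pattern is arranged in the same pattern. [folklore] -/
theorem isArrangedIn_image {T : Set E3} {P : Finset E3} (hT : IsArrangedIn T P) (B : E3 →ₗᵢ[ℝ] E3) :
    IsArrangedIn (B '' T) P := by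
  obtain ⟨A, rfl⟩ := hT
  refine ⟨B.comp A, ?_⟩
  rw [Set.image_image]
  refine Set.image_congr' fun p => ?_
  simp

/-! ## The stub -/

/-- **`stub_layeringIdeal` of line `c-layer-witness-strictness`, verbatim, sorry-free**: at the ideal ratio
`h² = 2a²/3`, a rooted set all of whose `6a/5`-stars are linearly rotated Barlow 13-point stars is one linearly
rotated Barlow stacking. [cite: HalesDSP2012, §1.3] -/
theorem stub_layeringIdeal_proof :
    ∀ (a h : ℝ), 0 < a → 0 < h → h ^ 2 = 2 * a ^ 2 / 3 →
    ∀ Y : Set E3, (0 : E3) ∈ Y →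
      (∀ y ∈ Y, ∃ s : ℤ → ℤ, IsHaggSeq s ∧ ∃ B : E3 →ₗᵢ[ℝ] E3,
        ((fun z => z - y) '' Y) ∩ Metric.closedBall 0 (6 * a / 5) =
          B '' (barlowStacking a h s ∩ Metric.closedBall 0 (6 * a / 5))) →
      ∃ s : ℤ → ℤ, IsHaggSeq s ∧ ∃ A : E3 →ₗᵢ[ℝ] E3, Y = A '' barlowStacking a h s := by
  intro a h ha hh hid Y hY0 hloc
  have hid' : h ^ 2 = 2 / 3 * a ^ 2 := by rw [hid]; ring
  -- the scaling factor
  set c : ℝ := 2 / a with hcdef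
  have hc : 0 < c := div_pos two_pos ha
  have e1 : c * a = 2 := by rw [hcdef]; field_simp
  have e2 : c * h = 2 * Real.sqrt (2 / 3) := by
    rw [h_eq_of_ideal ha hh hid, ← mul_assoc, e1]
  -- the model stackings are the scaled `(a, h)`-stackings
  have hM : ∀ s : ℤ → ℤ, barlowStacking 2 (2 * Real.sqrt (2 / 3)) s =
      (fun x : E3 => c • x) '' barlowStacking a h s := fun s => by
    have e := barlowStacking_scale c a h s
    rwa [e1, e2] at e
  have h0S : ∀ s : ℤ → ℤ, (0 : E3) ∈ barlowStacking a h s := fun s => by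
    simpa [barlowPos_zero] using (barlowPos_mem (a := a) (h := h) (s := s) 0 0 0)
  have h0M : ∀ s : ℤ → ℤ, (0 : E3) ∈ barlowStacking 2 (2 * Real.sqrt (2 / 3)) s := fun s => by
    simpa [barlowPos_zero] using
      (barlowPos_mem (a := 2) (h := 2 * Real.sqrt (2 / 3)) (s := s) 0 0 0)
  -- a star element of norm `< 6a/5`: membership transfer
  have hstarmem : ∀ {y y' : E3}, y ∈ Y → y' ∈ Y → dist y' y ≤ 6 * a / 5 →
      y' - y ∈ ((fun z => z - y) '' Y) ∩ Metric.closedBall (0 : E3) (6 * a / 5) :=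
    fun {y y'} _ hy' hd => ⟨⟨y', hy', rfl⟩, by rwa [Metric.mem_closedBall, dist_zero_right, ← dist_eq_norm]⟩
  -- the scaled set
  set V : Set E3 := (fun x : E3 => c • x) '' Y with hVdef
  -- (1) `V` is a packing of unit balls
  have hV : IsUnitBallPacking V := by
    rintro _ ⟨y, hy, rfl⟩ _ ⟨y', hy', rfl⟩ hd
    rw [dist_smul₀, Real.norm_eq_abs, abs_of_pos hc] at hd
    have hd' : dist y y' < a := by
      by_contra hge
      push Not at hge
      have : c * a ≤ c * dist y y' := mul_le_mul_of_nonneg_left hge hc.le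
      linarith
    by_contra hne
    have hyy : y' ≠ y := by
      intro e; exact hne (by rw [e])
    obtain ⟨s, hs, B, hstar⟩ := hloc y hy
    have hmem := hstarmem hy hy' (by rw [dist_comm]; linarith)
    rw [hstar] at hmem
    obtain ⟨w, ⟨hw, -⟩, hwe⟩ := hmem
    have hw0 : w ≠ 0 := by
      intro h0
      rw [h0, map_zero, eq_comm, sub_eq_zero] at hwe
      exact hyy hwe
    have hge := le_dist_of_mem_barlowStacking_ideal hs ha hid' hw (h0S s) hw0
    rw [dist_zero_right, ← B.norm_map, hwe, ← dist_eq_norm, dist_comm] at hge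
    linarith
  -- (2) the kissing shells of `V` are FCC/HCP patterns
  have hsh : HasFccOrHcpShells V := by
    rintro _ ⟨y, hy, rfl⟩
    obtain ⟨s, hs, B, hstar⟩ := hloc y hy
    have hK : kissingShell V (c • y) = B '' kissingShell (barlowStacking 2 (2 * Real.sqrt (2 / 3)) s) 0 := by
      ext x
      simp only [mem_kissingShell_iff, Set.mem_image, zero_add]
      constructor
      · rintro ⟨⟨y', hy', hyx⟩, hx2⟩
        have hyx' : c • y' = c • y + x := hyx
        have hz : y' - y = c⁻¹ • x := by
          have e : c • (y' - y) = x := by rw [smul_sub, hyx']; abel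
          rw [← e, smul_smul, inv_mul_cancel₀ hc.ne', one_smul]
        have hnorm : ‖y' - y‖ = a := by
          rw [hz, norm_smul, norm_inv, Real.norm_eq_abs, abs_of_pos hc, hx2, hcdef]
          field_simp
        have hmem := hstarmem hy hy' (by rw [dist_eq_norm, hnorm]; linarith)
        rw [hstar] at hmem
        obtain ⟨w, ⟨hw, -⟩, hwe⟩ := hmem
        have hwn : ‖w‖ = a := by rw [← B.norm_map, hwe, hnorm]
        refine ⟨c • w, ⟨?_, ?_⟩, ?_⟩
        · rw [hM s]; exact ⟨w, hw, rfl⟩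
        · rw [norm_smul, Real.norm_eq_abs, abs_of_pos hc, hwn, e1]
        · rw [B.map_smul, hwe, hz, smul_smul, mul_inv_cancel₀ hc.ne', one_smul]
      · rintro ⟨w', ⟨hw'M, hw'2⟩, rfl⟩
        rw [hM s] at hw'M
        obtain ⟨w, hw, rfl⟩ := hw'M
        have hwn : ‖w‖ = a := by
          rw [norm_smul, Real.norm_eq_abs, abs_of_pos hc] at hw'2
          have : c * ‖w‖ = c * a := by rw [hw'2, e1]
          exact mul_left_cancel₀ hc.ne' this
        have hBw : B w ∈ ((fun z => z - y) '' Y) ∩ Metric.closedBall (0 : E3) (6 * a / 5) := by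
          rw [hstar]
          refine ⟨w, ⟨hw, ?_⟩, rfl⟩
          rw [Metric.mem_closedBall, dist_zero_right, hwn]; linarith
        obtain ⟨⟨y', hy', hy'e⟩, -⟩ := hBw
        refine ⟨⟨y', hy', ?_⟩, ?_⟩
        · show c • y' = c • y + B (c • w)
          rw [B.map_smul, ← hy'e, smul_sub]; abel
        · rw [B.norm_map, norm_smul, Real.norm_eq_abs, abs_of_pos hc, hwn, e1]
    rw [hK]
    rcases Literature.Barriers.AtomisticToContinuum.HalesDSP_stackingShells_holds s hs 0 (h0M s) with hf | hh'
    · exact Or.inl (isArrangedIn_image hf B)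
    · exact Or.inr (isArrangedIn_image hh' B)
  -- (3) Hales, Dense Sphere Packings §1.3
  have h0V : (0 : E3) ∈ V := ⟨0, hY0, smul_zero c⟩
  obtain ⟨s₁, hs₁, g, hVg⟩ := HalesDSP_layerPackings_holds V hV ⟨0, h0V⟩ hsh
  -- (4) re-root at the preimage of `0` and linearise (Mazur–Ulam)
  have h0V' := h0V
  rw [hVg] at h0V'
  obtain ⟨x₀, hx₀, hgx₀⟩ := h0V'
  obtain ⟨k₀, i₀, j₀, rfl⟩ := hx₀
  set s₂ : ℤ → ℤ := fun m => s₁ (m + k₀) with hs₂def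
  have hs₂ : IsHaggSeq s₂ := fun m => hs₁ (m + k₀)
  set x₀ : E3 := barlowPos 2 (2 * Real.sqrt (2 / 3)) s₁ k₀ i₀ j₀ with hx₀def
  set T : E3 ≃ᵢ E3 := (IsometryEquiv.addRight x₀).trans g with hTdef
  have hT : ∀ z, T z = g (z + x₀) := fun z => by simp [hTdef]
  have hT0 : T 0 = 0 := by rw [hT, zero_add, hgx₀]
  set L : E3 ≃ₗᵢ[ℝ] E3 := T.toRealLinearIsometryEquivOfMapZero hT0 with hLdef
  have hL : ∀ z, L z = g (z + x₀) := fun z => by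
    rw [hLdef, IsometryEquiv.coe_toRealLinearIsometryEquivOfMapZero, hT]
  have hVL : V = L '' barlowStacking 2 (2 * Real.sqrt (2 / 3)) s₂ := by
    rw [hVg, hs₂def, ← barlowStacking_shift 2 (2 * Real.sqrt (2 / 3)) s₁ k₀ i₀ j₀, Set.image_image]
    refine Set.image_congr' fun x => ?_
    rw [hL, ← hx₀def, sub_add_cancel]
  -- (5) unscale
  refine ⟨s₂, hs₂, L.toLinearIsometry, ?_⟩
  ext y
  simp only [Set.mem_image, LinearIsometryEquiv.coe_toLinearIsometry]
  constructor
  · intro hy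
    have hcy : c • y ∈ V := ⟨y, hy, rfl⟩
    rw [hVL, hM s₂] at hcy
    obtain ⟨_, ⟨w, hw, rfl⟩, hLw⟩ := hcy
    refine ⟨w, hw, ?_⟩
    rw [LinearIsometryEquiv.map_smul] at hLw
    exact smul_right_injective E3 hc.ne' hLw
  · rintro ⟨w, hw, rfl⟩
    have hmem : L (c • w) ∈ V := by
      rw [hVL, hM s₂]; exact ⟨c • w, ⟨w, hw, rfl⟩, rfl⟩
    obtain ⟨y, hy, hye⟩ := hmem
    rw [LinearIsometryEquiv.map_smul] at hye
    have : y = L w := smul_right_injective E3 hc.ne' hye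
    rw [← this]; exact hy

end Summit.AtomisticToContinuum.Crystallization.Cruxes.SlackRigidity.DrefuteEvidence

end
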